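import Summits.QuantumFields.BalabanUV.Beta.FP.NestedDressingDescent

/-!
# `BalabanUV.Beta.FP.NestedDressingDescentFine` — road «FP» for binder row D1, RULING R-FP-45 (B) row (β-c) at model level, COROLLARY FILE to the OWNER's
# `FP/NestedDressingDescent` (p290624 ✓): THE NESTED SYSTEM's SLICED INVERTIBILITY IS THE ONE-STEP SYSTEM's (`h1 ⟹ hN`), THE CONJUGATION IDENTITY WITH ONE BINDER
# FEWER, AND THE INTERTWINING `Q₁·Π_nest = Π^c·Q₁`

HONEST DEPENDENCY (page 1, mandatory): continuum YM on T⁴ ⇐ BetaPertH ∧ nine spine estimates (0/9 proved); BetaPertH ⇐ (D1) ∧ (D4) ∧ CAP+tail;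
G-an2-4 gates asym, D1 and NE2/3/4.  HONEST FRAMING (cell contract, verbatim): «discharging `BetaPertH` makes Bałaban's UV stability UNCONDITIONAL —
a real constructive-QFT result; it is NOT the continuum limit and NOT the Clay problem.»  THIS MODULE DISCHARGES NOTHING of the wall: [folklore] finite-dimensional
linear algebra over an arbitrary field, composed BY NAME from the owner's `NestedDressingStepLaw.det_kkt_nestedDressed_eq_fineDressed` ∕ `NestedDressingDescent.*` and an5's
`CompositionSingular.mul_minOp` — nothing restated.  No `def`, no `def … : Prop`, nothing cited, 0 sorry; 0∕4 row-D1 binders; NOT SDF for the literal, NOT D1, NOT BetaPertH,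
NOT continuum, NOT Clay.  «not in print; our bookkeeping».

ABSOLUTE RULE (cell charter, verbatim): «No internally-minted statement may enter as a cited fact. Every hypothesis is either kernel-proved in this package or a
verbatim quotation of a PUBLISHED theorem with page reference. The manuscript(s) under audit are NOT citable for their own disputed steps — they are the thing
under adjudication; programme-internal (2001/route/tribunal) claims are never citable.»

WHY (XREAD X1 of `NestedDressingDescent`, certificate C-d1leaf02g14-1, NIT-1 ∕ INFO-1).  The owner's §3 theorems carry the binder `hN` (invertibility of the NESTED system's
sliced KKT matrix `kkt(Π_nestᵀHΠ_nest, [Q₁;τ₁])`) next to `h1` (the same for the ONE-STEP-dressed form).  By StepLaw §3 the two determinants are EQUAL for every `H` and `τ₁`,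
given any right inverse of `Q₁` — and `h1` itself supplies one (`Qʳ := ℋ₁·[1;0]`, `ℋ₁ = minOp`).  So `hN` is implied by `h1`: for the ROAD instance (SDF-EXACT, (β-c) at the
perfect objects) the nested system's sliced invertibility is NOT a separate obligation.  §2 records the INTERTWINING `Q₁·Π_nest = Π^c·Q₁` (the matrix form of R-FP-45 (B′)(iii)
and of leaf-06's Form-level `qbar_symAxProjNestAt_succ`), derived from the owner's §1.

CONTENTS (all [folklore]; notation of `NestedDressingDescent`).
* §1 **`isUnit_det_kkt_nestedDressed_of_fineDressed`** (`h1 ⟹ hN`), **`effForm_nestedDressed_eq_conj_of_fine`**, `effForm₁₁_nestedDressed_of_slice_of_fine`,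
  `effForm_nestedDressed_firstCol_of_fine` — the owner's three §3 theorems with `hN` struck.
* §2 **`avg_mul_nestedProj`** (`Q₁·Π_nest = Π^c·Q₁`).
Provenance: D1 formalisation swarm LEAF PROVER 02, unit b2b-balaban-beta-d1-formalise-leaf-02 gen 14, 2026-08-21 (XREAD X1 kit, probe (C1)(C3)(C3′)).
-/

namespace Summit.QuantumFields.BalabanUV.Beta.FP.NestedDressingDescentFine

noncomputable section

open Literature.MathematicalPhysics.QuantumFieldTheory.Balaban1983to89.Beta.Composition
open Literature.MathematicalPhysics.QuantumFieldTheory.Balaban1983to89.Beta.CompositionSingular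
open Summit.QuantumFields.BalabanUV.Beta.FP.NestedDressingStepLaw (det_kkt_nestedDressed_eq_fineDressed)
open Summit.QuantumFields.BalabanUV.Beta.FP.NestedDressingDescent
open scoped Matrix
open Matrix

variable {𝕜 : Type*} [Field 𝕜]
variable {ν μ ρ ρ₁ ρ₂ : Type*} [Fintype ν] [Fintype μ] [Fintype ρ] [Fintype ρ₁] [Fintype ρ₂]
  [DecidableEq ν] [DecidableEq μ] [DecidableEq ρ] [DecidableEq ρ₁] [DecidableEq ρ₂]

/-! ## §1 `h1 ⟹ hN` and the §3 theorems with one binder fewer -/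

/-- [folklore] **THE NESTED SYSTEM's SLICED KKT MATRIX IS INVERTIBLE AS SOON AS THE ONE-STEP-DRESSED ONE IS** (`h1 ⟹ hN`):
`NestedDressingStepLaw.det_kkt_nestedDressed_eq_fineDressed` (the two sliced determinants agree for every form and every second constraint block) at the right
inverse `Qʳ := minOp K₁ [Q₁;τ₁] · [1;0]` of `Q₁` supplied by `h1` itself (`CompositionSingular.mul_minOp`: `[Q₁;τ₁]·ℋ₁ = 1`). -/
theorem isUnit_det_kkt_nestedDressed_of_fineDressed (H : Matrix ν ν 𝕜) (Q₁ : Matrix μ ν 𝕜) (τ₁ : Matrix ρ ν 𝕜) (S₁ : Matrix ρ₁ ν 𝕜)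
    (Sc : Matrix ρ₂ μ 𝕜) (W₁ : Matrix ν ρ₁ 𝕜) (W₂ : Matrix ν ρ₂ 𝕜) (hQW₁ : Q₁ * W₁ = 0) (hT : IsUnit (S₁ * W₁).det)
    (hTc : IsUnit (Sc * (Q₁ * W₂)).det)
    (h1 : IsUnit (kkt ((1 - W₁ * (S₁ * W₁)⁻¹ * S₁)ᵀ * H * (1 - W₁ * (S₁ * W₁)⁻¹ * S₁)) (fromRows Q₁ τ₁)).det) :
    IsUnit (kkt ((1 - fromCols W₂ W₁ * (fromRows (Sc * Q₁) S₁ * fromCols W₂ W₁)⁻¹ * fromRows (Sc * Q₁) S₁)ᵀ * H *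
          (1 - fromCols W₂ W₁ * (fromRows (Sc * Q₁) S₁ * fromCols W₂ W₁)⁻¹ * fromRows (Sc * Q₁) S₁)) (fromRows Q₁ τ₁)).det := by
  set K₁ : Matrix ν ν 𝕜 := (1 - W₁ * (S₁ * W₁)⁻¹ * S₁)ᵀ * H * (1 - W₁ * (S₁ * W₁)⁻¹ * S₁) with hK₁
  have hQ₁C : Q₁ = fromCols (1 : Matrix μ μ 𝕜) (0 : Matrix μ ρ 𝕜) * fromRows Q₁ τ₁ := by
    rw [fromCols_mul_fromRows, Matrix.one_mul, Matrix.zero_mul, add_zero]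
  have hQr : Q₁ * (minOp K₁ (fromRows Q₁ τ₁) * fromRows (1 : Matrix μ μ 𝕜) (0 : Matrix ρ μ 𝕜)) = 1 := by
    have h2 : fromCols (1 : Matrix μ μ 𝕜) (0 : Matrix μ ρ 𝕜) * (fromRows Q₁ τ₁ * minOp K₁ (fromRows Q₁ τ₁)) =
        Q₁ * minOp K₁ (fromRows Q₁ τ₁) := by
      rw [← Matrix.mul_assoc, ← hQ₁C]
    rw [← Matrix.mul_assoc, ← h2, mul_minOp K₁ _ h1, Matrix.mul_one, fromCols_mul_fromRows, Matrix.one_mul,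
      Matrix.zero_mul, add_zero]
  rw [det_kkt_nestedDressed_eq_fineDressed H Q₁ τ₁ S₁ Sc W₁ W₂ hQW₁ hT hTc _ hQr]
  exact h1

/-- [folklore] `NestedDressingDescent.effForm_nestedDressed_firstCol` WITHOUT the binder `hN`. -/
theorem effForm_nestedDressed_firstCol_of_fine (H : Matrix ν ν 𝕜) (Q₁ : Matrix μ ν 𝕜) (τ₁ : Matrix ρ ν 𝕜) (S₁ : Matrix ρ₁ ν 𝕜)
    (Sc : Matrix ρ₂ μ 𝕜) (W₁ : Matrix ν ρ₁ 𝕜) (W₂ : Matrix ν ρ₂ 𝕜) (hQW₁ : Q₁ * W₁ = 0) (hT : IsUnit (S₁ * W₁).det)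
    (hTc : IsUnit (Sc * (Q₁ * W₂)).det)
    (h1 : IsUnit (kkt ((1 - W₁ * (S₁ * W₁)⁻¹ * S₁)ᵀ * H * (1 - W₁ * (S₁ * W₁)⁻¹ * S₁)) (fromRows Q₁ τ₁)).det) :
    effForm ((1 - fromCols W₂ W₁ * (fromRows (Sc * Q₁) S₁ * fromCols W₂ W₁)⁻¹ * fromRows (Sc * Q₁) S₁)ᵀ * H *
          (1 - fromCols W₂ W₁ * (fromRows (Sc * Q₁) S₁ * fromCols W₂ W₁)⁻¹ * fromRows (Sc * Q₁) S₁)) (fromRows Q₁ τ₁) *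
        fromRows (1 : Matrix μ μ 𝕜) (0 : Matrix ρ μ 𝕜) =
      (fromBlocks (1 - Q₁ * W₂ * (Sc * (Q₁ * W₂))⁻¹ * Sc) (0 : Matrix μ ρ 𝕜) (-(τ₁ * W₂ * (Sc * (Q₁ * W₂))⁻¹ * Sc)) (1 : Matrix ρ ρ 𝕜))ᵀ *
          effForm ((1 - W₁ * (S₁ * W₁)⁻¹ * S₁)ᵀ * H * (1 - W₁ * (S₁ * W₁)⁻¹ * S₁)) (fromRows Q₁ τ₁) *
          fromBlocks (1 - Q₁ * W₂ * (Sc * (Q₁ * W₂))⁻¹ * Sc) (0 : Matrix μ ρ 𝕜) (-(τ₁ * W₂ * (Sc * (Q₁ * W₂))⁻¹ * Sc)) (1 : Matrix ρ ρ 𝕜) *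
        fromRows (1 : Matrix μ μ 𝕜) (0 : Matrix ρ μ 𝕜) :=
  effForm_nestedDressed_firstCol H Q₁ τ₁ S₁ Sc W₁ W₂ hQW₁ hT hTc h1
    (isUnit_det_kkt_nestedDressed_of_fineDressed H Q₁ τ₁ S₁ Sc W₁ W₂ hQW₁ hT hTc h1)

/-- [folklore] `NestedDressingDescent.effForm₁₁_nestedDressed_of_slice` WITHOUT the binder `hN`: `(𝒮^{nest})₁₁ = Π^{cᵀ}·𝒮₁₁·Π^c`. -/
theorem effForm₁₁_nestedDressed_of_slice_of_fine (H : Matrix ν ν 𝕜) (Q₁ : Matrix μ ν 𝕜) (τ₁ : Matrix ρ₁ ν 𝕜) (S₁ : Matrix ρ₁ ν 𝕜)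
    (Sc : Matrix ρ₂ μ 𝕜) (W₁ : Matrix ν ρ₁ 𝕜) (W₂ : Matrix ν ρ₂ 𝕜) (hQW₁ : Q₁ * W₁ = 0) (hT : IsUnit (S₁ * W₁).det)
    (hTc : IsUnit (Sc * (Q₁ * W₂)).det) (hτ : IsUnit (τ₁ * W₁).det)
    (h1 : IsUnit (kkt ((1 - W₁ * (S₁ * W₁)⁻¹ * S₁)ᵀ * H * (1 - W₁ * (S₁ * W₁)⁻¹ * S₁)) (fromRows Q₁ τ₁)).det) :
    (effForm ((1 - fromCols W₂ W₁ * (fromRows (Sc * Q₁) S₁ * fromCols W₂ W₁)⁻¹ * fromRows (Sc * Q₁) S₁)ᵀ * H *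
          (1 - fromCols W₂ W₁ * (fromRows (Sc * Q₁) S₁ * fromCols W₂ W₁)⁻¹ * fromRows (Sc * Q₁) S₁)) (fromRows Q₁ τ₁)).toBlocks₁₁ =
      (1 - Q₁ * W₂ * (Sc * (Q₁ * W₂))⁻¹ * Sc)ᵀ *
        (effForm ((1 - W₁ * (S₁ * W₁)⁻¹ * S₁)ᵀ * H * (1 - W₁ * (S₁ * W₁)⁻¹ * S₁)) (fromRows Q₁ τ₁)).toBlocks₁₁ *
        (1 - Q₁ * W₂ * (Sc * (Q₁ * W₂))⁻¹ * Sc) :=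
  effForm₁₁_nestedDressed_of_slice H Q₁ τ₁ S₁ Sc W₁ W₂ hQW₁ hT hTc hτ h1
    (isUnit_det_kkt_nestedDressed_of_fineDressed H Q₁ τ₁ S₁ Sc W₁ W₂ hQW₁ hT hTc h1)

/-- [folklore] **THE FULL CONJUGATION IDENTITY WITH ONE BINDER FEWER** (`NestedDressingDescent.effForm_nestedDressed_eq_conj` without `hN`):
`𝒮(Π_nestᵀHΠ_nest,[Q₁;τ₁]) = Mᵀ·𝒮(Π₁ᵀHΠ₁,[Q₁;τ₁])·M`. -/
theorem effForm_nestedDressed_eq_conj_of_fine (H : Matrix ν ν 𝕜) (Q₁ : Matrix μ ν 𝕜) (τ₁ : Matrix ρ₁ ν 𝕜) (S₁ : Matrix ρ₁ ν 𝕜)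
    (Sc : Matrix ρ₂ μ 𝕜) (W₁ : Matrix ν ρ₁ 𝕜) (W₂ : Matrix ν ρ₂ 𝕜) (hQW₁ : Q₁ * W₁ = 0) (hT : IsUnit (S₁ * W₁).det)
    (hTc : IsUnit (Sc * (Q₁ * W₂)).det) (hτ : IsUnit (τ₁ * W₁).det)
    (h1 : IsUnit (kkt ((1 - W₁ * (S₁ * W₁)⁻¹ * S₁)ᵀ * H * (1 - W₁ * (S₁ * W₁)⁻¹ * S₁)) (fromRows Q₁ τ₁)).det) :
    effForm ((1 - fromCols W₂ W₁ * (fromRows (Sc * Q₁) S₁ * fromCols W₂ W₁)⁻¹ * fromRows (Sc * Q₁) S₁)ᵀ * H *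
          (1 - fromCols W₂ W₁ * (fromRows (Sc * Q₁) S₁ * fromCols W₂ W₁)⁻¹ * fromRows (Sc * Q₁) S₁)) (fromRows Q₁ τ₁) =
      (fromBlocks (1 - Q₁ * W₂ * (Sc * (Q₁ * W₂))⁻¹ * Sc) (0 : Matrix μ ρ₁ 𝕜) (-(τ₁ * W₂ * (Sc * (Q₁ * W₂))⁻¹ * Sc)) (1 : Matrix ρ₁ ρ₁ 𝕜))ᵀ *
        effForm ((1 - W₁ * (S₁ * W₁)⁻¹ * S₁)ᵀ * H * (1 - W₁ * (S₁ * W₁)⁻¹ * S₁)) (fromRows Q₁ τ₁) *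
        fromBlocks (1 - Q₁ * W₂ * (Sc * (Q₁ * W₂))⁻¹ * Sc) (0 : Matrix μ ρ₁ 𝕜) (-(τ₁ * W₂ * (Sc * (Q₁ * W₂))⁻¹ * Sc)) (1 : Matrix ρ₁ ρ₁ 𝕜) :=
  effForm_nestedDressed_eq_conj H Q₁ τ₁ S₁ Sc W₁ W₂ hQW₁ hT hTc hτ h1
    (isUnit_det_kkt_nestedDressed_of_fineDressed H Q₁ τ₁ S₁ Sc W₁ W₂ hQW₁ hT hTc h1)

/-! ## §2 The intertwining -/

omit [Fintype ρ] [DecidableEq ρ] in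
/-- [folklore] **THE AVERAGING INTERTWINES THE NESTED PROJECTOR WITH THE BLOCK-LEVEL PROJECTOR**: `Q₁·Π_nest = Π^c·Q₁`
(`NestedDressingDescent.nestedProj_eq_fineProj_mul` + `avg_mul_coarseAdj` + `Q₁·Π₁ = Q₁` from `Q₁W₁ = 0`; the matrix form of R-FP-45 (B′)(iii)). -/
theorem avg_mul_nestedProj (Q₁ : Matrix μ ν 𝕜) (S₁ : Matrix ρ₁ ν 𝕜) (Sc : Matrix ρ₂ μ 𝕜) (W₁ : Matrix ν ρ₁ 𝕜) (W₂ : Matrix ν ρ₂ 𝕜)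
    (hQW₁ : Q₁ * W₁ = 0) (hT : IsUnit (S₁ * W₁).det) (hTc : IsUnit (Sc * (Q₁ * W₂)).det) :
    Q₁ * (1 - fromCols W₂ W₁ * (fromRows (Sc * Q₁) S₁ * fromCols W₂ W₁)⁻¹ * fromRows (Sc * Q₁) S₁) =
      (1 - Q₁ * W₂ * (Sc * (Q₁ * W₂))⁻¹ * Sc) * Q₁ := by
  have hQP : Q₁ * (1 - W₁ * (S₁ * W₁)⁻¹ * S₁) = Q₁ := by
    rw [Matrix.mul_sub, Matrix.mul_one, ← Matrix.mul_assoc, ← Matrix.mul_assoc, hQW₁, Matrix.zero_mul, Matrix.zero_mul, sub_zero]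
  rw [nestedProj_eq_fineProj_mul Q₁ S₁ Sc W₁ W₂ hQW₁ hT hTc, ← Matrix.mul_assoc, hQP]
  exact avg_mul_coarseAdj Q₁ Sc W₂

end

end Summit.QuantumFields.BalabanUV.Beta.FP.NestedDressingDescentFine
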